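import Summits.FinalStateConjecture.FinalStateConjecture.Theses.PhaseMixingCapture
import Summits.FinalStateConjecture.FinalStateConjecture.Theorems.BulkKerrCapture.Negative.SpinGapAndMass
import Literature.Geometry.Lorentzian.StabilityCauchy

/-!
# Line `frozen-charge-flat-modulus` — checked skeleton for the crux `BulkKerrCapture`
(stmt-FinalStateConjecture-10696, route `PhaseMixingCapture`, rank 4)

Skeleton v2.1-pub (line lead gen 1, `prover-line-stmt-FinalStateConjecture-10696-1`, 2026-08-16): S4
`stub_spinReflection` is CLOSED (landed p83858, imported); otherwise v2 = the
planner's v1 verbatim except that the four registered stubs now carry their signatures EXPLICITLY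
(the bodies of `LocalKerrConvergence`, `FarCompleteNullInfinity`, `LipschitzFinalState`,
`SpinReflection`, unfolded), so that a worker's `--supports` file can state the registered
signature without importing this (non-module) workfile; the `def`s are kept as documentation and
the composition is unchanged (definitional unfolding).

Planner seat `planner-cruxplan-stmt-FinalStateConjecture-10696-frozen-charge-flat-m-0`, 2026-08-16
(crux-plan, round 1; idea card `Cruxes/BulkKerrCapture/Ideas/frozen-charge-flat-modulus.md`, triage
`TRIAGE-r1-{1,2,3}.md`: pass ×3, merge-partner `modulus-rides-the-nash-moser-unknown`; line card
`Lines/frozen-charge-flat-modulus.md`).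

Crux decl: `Summit.FinalStateConjecture.FinalStateConjecture.Theses.PhaseMixingCapture.BulkKerrCapture`,
concluded BY NAME by `BulkKerrCapture_of` (a closed term over the four registered stubs; every other
declaration in this file is proved).

## The line in one paragraph

The crux is the member `C·√dist` of the capture family at the fixed horizon-penetrating leaf
`r₀ = M`, with `(ε, C)` uniform on the compact spin sets `|a| ≤ a₁M`, `a₁ < 1`
(`Negative.bulkKerrCapture_iff`). The idea: DIFFERENTIATE the final-state map `D ↦ (M_f, |a_f|)`
instead of tracking it — the Nash–Moser step of Hintz's full-subextremal-range theorem
(arXiv:2606.28253, §13.1 Steps 3–4: `b − b₀` is a component of the Saint-Raymond unknown `U`)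
delivers `|U| ≲ ‖P(Ψ(0))‖ ≲ dist` (the output bound is in [SR89]'s PROOF; printed precedent
Hintz–Vasy arXiv:1606.04014 Thm 11.2 / Thm 13.1 `|c| ≤ C‖d‖`), i.e. a LIPSCHITZ parameter modulus,
locally uniformly in the sub-extremal centre; `C·dist ≤ C·√dist` on balls of radius `≤ 1`
(`captureAt_of_captureLin`, proved) and a Lebesgue-number argument on `[−a₁, a₁] ⊂ (−1, 1)`
(`captureAt_uniform_of_local`, proved, with the `(s, δ, k, C)`-monotonicity of the capture body
`captureAt_mono_exponents` PROVED here from the PROVED monotonicity of the tree's weighted Sobolev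
distance in its exponents, `dataWeightedSobolevEDist_mono_exponents` — the ideator's routine stub
`BodyMonoExponents` is thereby discharged, not registered). The `√` of the crux has slack `3/2`
(the card's (ii): `DF|_{Kerr} = 0` on the frozen-charge ball, so the truth is quadratic) — kept as
the EXPLANATION in the line card, not a stub (triage sharpenings T1–T3).

## Registered stubs (the only `sorry`s), per normalised centre `χ₀ = a₀/M ∈ (−1, 1)`

* `stub_localKerrConvergence : LocalKerrConvergence` [XL, the VENDORED theorem, modulus-free, as
  printed] — near every sub-extremal centre, for every `k`, one `(s, δ, η)` and per mass one basin
  `ε` such that every vacuum datum in the `H^s_δ`-ball of radius `ε` around `Kerr.data M a M`,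
  `|a/M − χ₀| < η`, has all its maximal vacuum Cauchy developments converging in `Cᵏ`
  (`Spacetime.ConvergesToKerr`) to SOME sub-extremal Kerr exterior. Hintz Thm 1.1 / 13.1 at finite
  regularity (triage G1), basin uniform near the centre by Rem 13.2 ¶2 (tail tolerance at a fixed
  centre), leaf transfer `{t* = 0} ↝ Σ_IVP` (Rem 13.3, triage S2), chart conversion, CBG uniqueness.
* `stub_farCompleteNullInfinity : FarCompleteNullInfinity` [L, the censorship clause] — on the
  same kind of local ball, every MGHD has complete `𝓘⁺` seen from the far region of the leaf
  (`DataEmbedding.HasCompleteFutureNullInfinityFar`, Christodoulou's sojourn form). Hintz Thm 13.1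
  rates (3)–(4) (`O(r⁻¹)` incl. near `𝓘⁺`, polyhomogeneous radiation field) + null-geodesic
  comparison (Christodoulou CQG 1999; Dafermos–Rodnianski arXiv:0811.0354 §2.6.2) + CBG transport.
* `stub_lipschitzFinalState : LipschitzFinalState` [L/XL, THIS CARD'S LEVER (i), F6 of the panel]
  — near every sub-extremal centre one `(s, δ, k₀, η)` and per mass `(ε, L)` such that for every
  datum in the ball, EVERY sub-extremal Kerr limit `(M', a')` in `Cᵏ`, `k ≥ k₀`, of every MGHD
  satisfies `|M' − M| + ||a'| − |a|| ≤ L · dist(D, Kerr.data M a M)`: mass and spin MAGNITUDE of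
  the final state are Lipschitz in the data. (`ConvergesToKerr` is blind to the orientation of the
  spin — `stub_spinReflection` — so only `|a'|` is determined; a version with `|a' − a|` for all
  limits would be FALSE.) Nash–Moser output bound (Hintz §13.1 Step 3 + [SR89, proof]; HV16
  Thm 11.2/13.1) + `F(Kerr_a) = (M, a)` (`Negative.captureAt_atKerrData`) + uniqueness of the
  limit parameters up to spin orientation (final Bondi mass / curvature invariants for `k ≥ k₀`).
* `stub_spinReflection : SpinReflection` [M in Lean, trivial on paper] — `ConvergesToKerr 𝒟 M a k
  → ConvergesToKerr 𝒟 M (−a) k`: the Kerr–Schild form of the tree satisfies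
  `R^* g_{M,−a} = g_{M,a}` for the reflection `R(x⁰,x¹,x²,x³) = (x⁰,x¹,−x²,x³)` (`Kerr.radius`,
  `Kerr.scalarH` depend on `a²`; `Kerr.nullCovectorFun`'s `x¹, x²` components swap sign pattern),
  `R` preserves `t* = x⁰`, `r` and `Kerr.exterior`, and precomposition with a linear isometry
  preserves the `Cᵏ` sup norms of the deviation.

Composition (all proved below): stubs ⇒ `captureLin_local` (two-centre capture with LINEAR
modulus = the card's `C⁺ = TwoCentreKerrCaptureLin`, sign of `a'` fixed by reflection) ⇒
`captureAt_local` (`ε ≤ 1`, `d ≤ √d`) ⇒ `captureAt_uniform_of_local` (finite subcover, proved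
monotonicity) ⇒ `BulkKerrCapture_of` (`Negative.bulkKerrCapture_iff`).

Disproof used (`Cruxes/BulkKerrCapture/Disproof.lean`, cycles 1–2, read 2026-08-16T02:05Z): the
composition imports the LANDED negative files `Negative/SpinGapAndMass.lean` (p73266) and
`Negative/PointwiseVsUniform.lean` (p73746) and works over the disprover's own matrix `CaptureAt`;
`_false_without_spinGap` is honoured — every centre is `|χ₀| < 1`, the strict gap `a₁ < 1` is used
exactly once (`[−a₁, a₁] ⊂ (−1, 1)` in `captureAt_uniform_of_local`) and the vacuous range `a₁ < 0`
is `Negative.no_spin_of_neg`; `_false_without_posMass` — `0 < M` is used to form `a/M`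
(`abs_of_pos hM`); §3c/§5(c) — every stub has `s` existential AFTER the centre (provers take
`s ≥ 2`, indeed `s = d(χ₀, k) ≫ 2`); §5(d) — the inner radius never moves (`r₀ = M` in every stub);
§5(e)/G1 — the stubs are stated on the tree's finite-`s` balls, so the vendored form must be the
finite-regularity one (recorded in each stub docstring); no stub is an instance of a refuted member of
`BulkCaptureFamily` (none weakens `a₁ < 1` or `0 < M`).
-/

noncomputable section

-- the crux-workfile namespace prescribed by the protocol repeats the summit name
set_option linter.dupNamespace false

open Set Filter MeasureTheory TopologicalSpace
open scoped Manifold ENNReal ContDiff Topology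

namespace Summit.FinalStateConjecture.FinalStateConjecture.Cruxes.BulkKerrCapture.FrozenChargeFlatModulus

open Literature.Geometry.Lorentzian
open Summit.FinalStateConjecture.FinalStateConjecture.Theses.PhaseMixingCapture (BulkKerrCapture)
open Summit.FinalStateConjecture.FinalStateConjecture.Theorems.BulkKerrCapture.Negative
  (CaptureAt bulkKerrCapture_iff no_spin_of_neg)

/-! ## §1 Stub statements (precise `Prop`s over existing declarations) -/

/-- **S1 · local Kerr convergence (the vendored stability theorem, qualitative, modulus-free).**
For every sub-extremal normalised centre `χ₀ ∈ (−1, 1)` and every `k : ℕ` there are exponents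
`(s, δ)` and a spin radius `η > 0` such that for every mass `M > 0` ONE basin `ε > 0` serves every
spin `a` with `|a/M − χ₀| < η`, `|a| < M`, each on its own leaf `Kerr.slice a M = {t* = 0, r > M}`:
every vacuum-constraint solution `D` within `H^s_δ`-distance `ε` of `Kerr.data M a M` has all its
maximal vacuum Cauchy developments converging in `Cᵏ` (`Spacetime.ConvergesToKerr`, Kerr–Schild
pullback gauge, sup over full slabs `{t* = τ}`) to some SUB-EXTREMAL Kerr exterior `g_{M',a'}`.
No parameter closeness is asserted (that is S3). Size XL: Hintz arXiv:2606.28253 Thm 1.1 (p. 2) /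
Thm 13.1 (pp. 318–319) in a FINITE-REGULARITY form ((13.1a) with `H_b^{d'}` — triage G1: the
printed hypothesis is `H_b^∞`-conormal and covers no finite-`s` ball verbatim), basin uniform near
the centre at fixed `M` by Rem 13.2 ¶2 (p. 319: Kerr data of equal mass and nearby spin differ by
`O(|Δa|) r⁻², r⁻³` terms inside (13.1a)), the leaf transfer `{t* = 0} ↝ {t_IVP = 0}` (Rem 13.3,
pp. 319–320; triage S2: an evolution lemma through the logarithmic wedge, inner radius kept inside
`r₊` — Disproof §5(d)), conversion of rates (1)–(4) into a late Kerr–Schild chart with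
`deviationCk → 0`, and transport to EVERY maximal development by Choquet-Bruhat–Geroch uniqueness
(`CauchyDevelopment.IsIsometricTo`). Why it might fail: 509-page unrefereed preprint; the leaf
transfer and the chart conversion are unprinted (M-sized each). -/
def LocalKerrConvergence : Prop :=
  ∀ [Kerr.Facts] [Kerr.SliceFacts], ∀ χ₀ : ℝ, |χ₀| < 1 → ∀ k : ℕ, ∃ (s : ℕ) (δ : ℝ),
    ∃ η > (0 : ℝ), ∀ (M : ℝ) (hM : 0 < M), ∃ ε > (0 : ℝ), ∀ a : ℝ, |a / M - χ₀| < η → |a| < M →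
      ∀ (D : InitialDataSet 𝓘(ℝ, E3) (Kerr.slice a M)) [D.metric.HasLeviCivita],
        D.IsVacuumConstraintSolution →
        InitialDataSet.dataWeightedSobolevEDist s δ D (Kerr.data M a M hM.le) <
          ENNReal.ofReal ε →
        ∀ 𝒟 : VacuumCauchyDevelopment D, 𝒟.IsMaximal →
          ∃ (M' a' : ℝ) (𝒟oc : Set 𝒟.carrier), Kerr.IsSubextremal M' a' ∧
            𝒟.toSpacetime.ConvergesToKerr 𝒟oc M' a' k

/-- **S2 · far-complete null infinity (the censorship clause of the crux).** Near every
sub-extremal normalised centre there are `(s, δ, η)` and per mass one basin `ε` such that every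
maximal vacuum Cauchy development of every vacuum datum in the ball has complete future null
infinity as seen from the closed far region `{‖y‖ ≥ Kerr.afRadius a M + 1}` of the leaf
(`DataEmbedding.HasCompleteFutureNullInfinityFar`, Christodoulou's sojourn form with far origins —
the all-origin form is false on truncated leaves, Disproof §4). Size L: the far-zone output of
Hintz arXiv:2606.28253 Thm 13.1 ((3) `t*⁻¹ log t*` in the wave zone, (4) `O(r⁻¹)` for
`r/t* ≥ C` including near `𝓘⁺`, with the partially polyhomogeneous radiation field of §13) turned
into affine completeness / long sojourn of far outgoing and ingoing null rays by comparison with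
Kerr's null geodesics (Christodoulou, CQG 16 (1999) A23, pp. A26–A27; Dafermos–Rodnianski
arXiv:0811.0354 §2.6.2, §5.1), plus Cauchy stability in the early region `0 ≤ t* ≤ τ₀` and CBG
transport to every maximal development. Why it might fail: mere `sup`-closeness of the metric does
not control affine parameters over infinite ranges — the proof needs the STRUCTURED far-field decay
of the source, not just `ConvergesToKerr`; the ingoing far rays must be followed until they enter
`J⁺(ι B₀)` (sojourn `≳ (R + R₀)/2`, Disproof module docstring "centre"). -/
def FarCompleteNullInfinity : Prop :=
  ∀ [Kerr.Facts] [Kerr.SliceFacts], ∀ χ₀ : ℝ, |χ₀| < 1 → ∃ (s : ℕ) (δ : ℝ),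
    ∃ η > (0 : ℝ), ∀ (M : ℝ) (hM : 0 < M), ∃ ε > (0 : ℝ), ∀ a : ℝ, |a / M - χ₀| < η → |a| < M →
      ∀ (D : InitialDataSet 𝓘(ℝ, E3) (Kerr.slice a M)) [D.metric.HasLeviCivita],
        D.IsVacuumConstraintSolution →
        InitialDataSet.dataWeightedSobolevEDist s δ D (Kerr.data M a M hM.le) <
          ENNReal.ofReal ε →
        ∀ 𝒟 : VacuumCauchyDevelopment D, 𝒟.IsMaximal → 𝒟.HasCompleteFutureNullInfinityFar

/-- **S3 · Lipschitz final state (THIS LINE'S LEVER: the final-state map is Lipschitz in the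
data, locally uniformly in the centre).** Near every sub-extremal normalised centre `χ₀` there are
`(s, δ, k₀, η)` and per mass `M > 0` a basin `ε > 0` and a constant `L` such that for every spin
`a` with `|a/M − χ₀| < η`, `|a| < M`, every vacuum datum `D` in the `H^s_δ`-ball of radius `ε`
around `Kerr.data M a M`, every maximal vacuum Cauchy development `𝒟` of `D` and EVERY sub-extremal
Kerr exterior `g_{M',a'}` to which some region of `𝒟` converges in `Cᵏ`, `k ≥ k₀`:
`|M' − M| + ||a'| − |a|| ≤ L · dist_{s,δ}(D, Kerr.data M a M)`. Only the spin MAGNITUDE appears: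
`ConvergesToKerr` cannot see the orientation of the rotation axis (`SpinReflection`), so the same
development converges to `g_{M',a'}` and to `g_{M',−a'}`; the composition fixes the sign with S4.
Size L/XL. Mechanism (card (i), panel finding F6): in Hintz's scheme the final parameters
`b − b₀` are the first components of the Nash–Moser unknown `U` (arXiv:2606.28253 §13.1 Step 3,
pp. 321–322, Step 4 "the first two components of p⃗ = (b − b₀, S, …) encode the final Kerr black
hole parameters"), and Saint-Raymond's construction ([SR89], Enseign. Math. 35 (1989) 217–226 —
the bound is in the PROOF, the statement is existence-only: Hintz–Vasy arXiv:1606.04014 Thm 11.1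
verbatim) yields `|U|_{3d} ≤ C‖P(Ψ(0))‖_{2d'}` with `C` depending only on the tame constants
(printed precedent, same programme: HV16 Thm 13.1 "`|c| ≤ C‖d‖_{13,α}` … as follows from the proof
of Theorem 11.1 given in [SR89]", and Thm 11.2: the KdS solution map is a smooth tame map of the
data); `‖P(Ψ(0))‖ ≲ dist` is Lipschitz dependence of the local + exterior (Thm 5.17/5.23) solutions
on the data (printed `∀ε∃ε₀` only — the merge-partner card's residual (ii), M-sized); constants are
local in the centre (Rem 13.2) and `F(Kerr.data M a M) = (M, a)` exactly
(`Negative.captureAt_atKerrData`: the Nash–Moser solution at the centre is `U = 0`). The passage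
from "Hintz's limit obeys the bound" to "EVERY `Cᵏ`-limit, `k ≥ k₀`, obeys it" is uniqueness of the
asymptotic Kerr parameters of a one-ended development up to spin orientation (final Bondi mass and
angular momentum; or, for `k₀ ≥ 2`, local curvature invariants of Kerr near the horizon determine
`(M, |a|)`), `k₀` being the prover's choice. Why it might fail: a genuinely sub-Lipschitz
final-mass response `|M_f − M| ≳ dist^θ`, `θ < 1`, along some one-parameter family of vacuum data
at a sub-extremal spin (none expected: ADM charges are frozen on the ball for `δ ≥ 1/2` and the
fluxes are quadratic — the card's (ii) predicts `θ = 2`); or an exotic `Cᵏ`-Kerr limit of an MGHD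
of ball data with the wrong mass (excluded for large `k₀` by curvature rigidity). -/
def LipschitzFinalState : Prop :=
  ∀ [Kerr.Facts] [Kerr.SliceFacts], ∀ χ₀ : ℝ, |χ₀| < 1 → ∃ (s : ℕ) (δ : ℝ) (k₀ : ℕ),
    ∃ η > (0 : ℝ), ∀ (M : ℝ) (hM : 0 < M), ∃ ε > (0 : ℝ), ∃ L : ℝ, ∀ a : ℝ, |a / M - χ₀| < η →
      |a| < M →
      ∀ (D : InitialDataSet 𝓘(ℝ, E3) (Kerr.slice a M)) [D.metric.HasLeviCivita],
        D.IsVacuumConstraintSolution →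
        InitialDataSet.dataWeightedSobolevEDist s δ D (Kerr.data M a M hM.le) <
          ENNReal.ofReal ε →
        ∀ 𝒟 : VacuumCauchyDevelopment D, 𝒟.IsMaximal →
          ∀ (M' a' : ℝ) (𝒟oc : Set 𝒟.carrier) (k : ℕ), k₀ ≤ k → Kerr.IsSubextremal M' a' →
            𝒟.toSpacetime.ConvergesToKerr 𝒟oc M' a' k →
            |M' - M| + abs (|a'| - |a|) ≤
              L * (InitialDataSet.dataWeightedSobolevEDist s δ D (Kerr.data M a M hM.le)).toReal

/-- **S4 · spin reflection (orientation blindness of `ConvergesToKerr`).** If a spacetime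
converges in `Cᵏ` to `g_{M,a}` in a region `𝒟`, it converges in `Cᵏ` to `g_{M,−a}` in the same
region. Trivial on paper, M-sized in Lean: with `R(x⁰, x¹, x², x³) = (x⁰, x¹, −x², x³)` (a linear
isometry of `E4` preserving `t* = x⁰`, `E4.spatialNorm`, `x³`, hence `Kerr.radius a`, `Kerr.scalarH`
— both depend on `a` through `a²` — and `Kerr.exterior M a = Kerr.exterior M (−a)`), the
Kerr–Schild null covector satisfies `(Kerr.nullCovector (−a) (R x)) ∘ R = Kerr.nullCovector a x`
componentwise from `Kerr.nullCovectorFun` (`ℓ = (1, (r x¹ + a x²)/(r² + a²), (r x² − a x¹)/(r² +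
a²), x³/r)`), so `R^* (Kerr.bilin M (−a)) = Kerr.bilin M a`; for a late embedding `Ψ` modelled on
`Kerr.background M a`, `Ψ ∘ R` is a late embedding modelled on `Kerr.background M (−a)` (same late
region and slabs, `IsOpenEmbedding` and `ContMDiff` compose with the linear homeomorphism `R`, the
causal-past covering clause has the same image sets), its deviation is `R^*` of the old one at
`R x`, and `‖D^m (f ∘ R) x‖ = ‖D^m f (R x)‖` for a linear isometry
(`LinearIsometryEquiv.norm_iteratedFDeriv_comp_right`), so `deviationCk` is unchanged and tends to
`0`. Kerr, PRL 11 (1963) eq. (5); Visser arXiv:0706.0622 (32)–(35). The pointwise identities are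
PROVED in §5b below (`kerr_bilin_reflectY`, `reflectY_mem_exterior`). Why it might fail: it cannot
on paper; the only risk is Lean plumbing (`mfderiv` of `Ψ ∘ R` on the open submanifold
`Kerr.exterior M a ⊆ E4`). -/
def SpinReflection : Prop :=
  ∀ (𝓢 : Spacetime.{0} 4) (𝒟 : Set 𝓢.carrier) (M a : ℝ) (k : ℕ),
    𝓢.ConvergesToKerr 𝒟 M a k → 𝓢.ConvergesToKerr 𝒟 M (-a) k

/-! ## §2 Registered stubs (the only `sorry`s of the line) -/

/-- **stub S1** `LocalKerrConvergence` [XL; vendor Hintz arXiv:2606.28253 Thm 13.1 in local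
finite-regularity consequence form at the inner radius `r₀ = M` — the fact the grounder and the
barrier audit WANT as `hintz2026_…` next to `klainerman_szeftel_kerr_stability_small_a_cauchy`]. -/
theorem stub_localKerrConvergence :
    ∀ [Kerr.Facts] [Kerr.SliceFacts], ∀ χ₀ : ℝ, |χ₀| < 1 → ∀ k : ℕ, ∃ (s : ℕ) (δ : ℝ),
      ∃ η > (0 : ℝ), ∀ (M : ℝ) (hM : 0 < M), ∃ ε > (0 : ℝ), ∀ a : ℝ, |a / M - χ₀| < η → |a| < M →
        ∀ (D : InitialDataSet 𝓘(ℝ, E3) (Kerr.slice a M)) [D.metric.HasLeviCivita],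
          D.IsVacuumConstraintSolution →
          InitialDataSet.dataWeightedSobolevEDist s δ D (Kerr.data M a M hM.le) <
            ENNReal.ofReal ε →
          ∀ 𝒟 : VacuumCauchyDevelopment D, 𝒟.IsMaximal →
            ∃ (M' a' : ℝ) (𝒟oc : Set 𝒟.carrier), Kerr.IsSubextremal M' a' ∧
              𝒟.toSpacetime.ConvergesToKerr 𝒟oc M' a' k := by
  sorry

/-- **stub S2** `FarCompleteNullInfinity` [L; far-zone rates (3)–(4) of Thm 13.1 ⇒ sojourn-complete
`𝓘⁺` from far origins, in every MGHD]. -/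
theorem stub_farCompleteNullInfinity :
    ∀ [Kerr.Facts] [Kerr.SliceFacts], ∀ χ₀ : ℝ, |χ₀| < 1 → ∃ (s : ℕ) (δ : ℝ),
      ∃ η > (0 : ℝ), ∀ (M : ℝ) (hM : 0 < M), ∃ ε > (0 : ℝ), ∀ a : ℝ, |a / M - χ₀| < η → |a| < M →
        ∀ (D : InitialDataSet 𝓘(ℝ, E3) (Kerr.slice a M)) [D.metric.HasLeviCivita],
          D.IsVacuumConstraintSolution →
          InitialDataSet.dataWeightedSobolevEDist s δ D (Kerr.data M a M hM.le) <
            ENNReal.ofReal ε →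
          ∀ 𝒟 : VacuumCauchyDevelopment D, 𝒟.IsMaximal → 𝒟.HasCompleteFutureNullInfinityFar := by
  sorry

/-- **stub S3** `LipschitzFinalState` [L/XL; THE LEVER: Nash–Moser output bound read as a Lipschitz
final-state estimate (Hintz §13.1 Steps 3–4 + [SR89, proof]; HV16 Thm 11.2 / 13.1 precedent) +
uniqueness of the limit parameters up to spin orientation]. -/
theorem stub_lipschitzFinalState :
    ∀ [Kerr.Facts] [Kerr.SliceFacts], ∀ χ₀ : ℝ, |χ₀| < 1 → ∃ (s : ℕ) (δ : ℝ) (k₀ : ℕ),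
      ∃ η > (0 : ℝ), ∀ (M : ℝ) (hM : 0 < M), ∃ ε > (0 : ℝ), ∃ L : ℝ, ∀ a : ℝ, |a / M - χ₀| < η →
        |a| < M →
        ∀ (D : InitialDataSet 𝓘(ℝ, E3) (Kerr.slice a M)) [D.metric.HasLeviCivita],
          D.IsVacuumConstraintSolution →
          InitialDataSet.dataWeightedSobolevEDist s δ D (Kerr.data M a M hM.le) <
            ENNReal.ofReal ε →
          ∀ 𝒟 : VacuumCauchyDevelopment D, 𝒟.IsMaximal →
            ∀ (M' a' : ℝ) (𝒟oc : Set 𝒟.carrier) (k : ℕ), k₀ ≤ k → Kerr.IsSubextremal M' a' →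
              𝒟.toSpacetime.ConvergesToKerr 𝒟oc M' a' k →
              |M' - M| + abs (|a'| - |a|) ≤
                L * (InitialDataSet.dataWeightedSobolevEDist s δ D (Kerr.data M a M hM.le)).toReal := by
  sorry

/-- **stub S4** `SpinReflection` — CLOSED: LANDED p83858 (commit a7ae1df254ed) as
`Summit.FinalStateConjecture.FinalStateConjecture.Theorems.stub_spinReflection`
(`Theorems/PhaseMixingCaptureBulkKerrCaptureStubSpinReflection.lean`, line lead gen 1, wave 1);
`R^* g_{M,−a} = g_{M,a}` for `R : x² ↦ −x²`, transport of `IsLateEmbedding`/`deviationCk`. -/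
theorem stub_spinReflection :
    ∀ (𝓢 : Spacetime.{0} 4) (𝒟 : Set 𝓢.carrier) (M a : ℝ) (k : ℕ),
      𝓢.ConvergesToKerr 𝒟 M a k → 𝓢.ConvergesToKerr 𝒟 M (-a) k := by
  -- CLOSED in the tree: `exact Summit.FinalStateConjecture.FinalStateConjecture.Theorems.stub_spinReflection`
  -- after `import Summits.FinalStateConjecture.FinalStateConjecture.Theorems.PhaseMixingCaptureBulkKerrCaptureStubSpinReflection`
  -- (p83858, commit a7ae1df254ed); kept as `sorry` in this published copy only because the farm
  -- had not yet built that module when this workfile was written (rc 75, 2026-08-16T06:15Z).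
  sorry

/-! ## §3 Glue, part 1 (PROVED): monotonicity of the weighted Sobolev distance in its exponents

The ideator's routine stub `BodyMonoExponents` and the triage's remark "(s, δ)-monotonicity is true
(more non-negative terms; base `1 + ‖x‖ ≥ 1`) but not yet in the tree" — discharged here. -/

section Mono

variable {F G : Type*} [NormedAddCommGroup F] [NormedSpace ℝ F] [NormedAddCommGroup G]
  [NormedSpace ℝ G] [MeasureSpace F]

/-- The weighted Sobolev `H^s_δ` seminorm is monotone in the order `s` and in the weight `δ`:
more (non-negative) terms, and `(1 + ‖x‖)^{2(δ+m)} ≤ (1 + ‖x‖)^{2(δ'+m)}` for `δ ≤ δ'` since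
`1 + ‖x‖ ≥ 1`. Bartnik, CPAM 39 (1986), (1.2). -/
theorem weightedSobolevSeminorm_mono_exponents (U : Set F) {s s' : ℕ} {δ δ' : ℝ} (hs : s ≤ s')
    (hδ : δ ≤ δ') (f : F → G) :
    weightedSobolevSeminorm U s δ f ≤ weightedSobolevSeminorm U s' δ' f := by
  unfold weightedSobolevSeminorm
  refine ENNReal.rpow_le_rpow ?_ (by norm_num)
  calc ∑ m ∈ Finset.range (s + 1),
        ∫⁻ x in U, ENNReal.ofReal ((1 + ‖x‖) ^ (2 * (δ + m) : ℝ) * ‖iteratedFDeriv ℝ m f x‖ ^ 2)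
      ≤ ∑ m ∈ Finset.range (s + 1),
        ∫⁻ x in U, ENNReal.ofReal ((1 + ‖x‖) ^ (2 * (δ' + m) : ℝ) *
          ‖iteratedFDeriv ℝ m f x‖ ^ 2) := by
        refine Finset.sum_le_sum fun m _ ↦ lintegral_mono fun x ↦ ENNReal.ofReal_le_ofReal ?_
        refine mul_le_mul_of_nonneg_right ?_ (sq_nonneg _)
        refine Real.rpow_le_rpow_of_exponent_le ?_ ?_
        · linarith [norm_nonneg x]
        · linarith
    _ ≤ ∑ m ∈ Finset.range (s' + 1),
        ∫⁻ x in U, ENNReal.ofReal ((1 + ‖x‖) ^ (2 * (δ' + m) : ℝ) *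
          ‖iteratedFDeriv ℝ m f x‖ ^ 2) := by
        apply Finset.sum_le_sum_of_subset_of_nonneg
        · exact fun x hx ↦ Finset.mem_range.2 ((Finset.mem_range.1 hx).trans_le (Nat.succ_le_succ hs))
        · intro i _ _
          exact zero_le

end Mono

/-- **The tree's data distance `dataWeightedSobolevEDist s δ` is monotone in `(s, δ)`**: the
`h`-part is `H^s_δ`, the `k`-part `H^{s−1}_{δ+1}`, both monotone by
`weightedSobolevSeminorm_mono_exponents` (`s − 1 ≤ s' − 1` in `ℕ`). Hence larger exponents SHRINK
the data ball of a capture statement. Bartnik, CPAM 39 (1986), (1.2). -/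
theorem dataWeightedSobolevEDist_mono_exponents {U : Opens E3} {s s' : ℕ} {δ δ' : ℝ}
    (hs : s ≤ s') (hδ : δ ≤ δ') (D₁ D₂ : InitialDataSet 𝓘(ℝ, E3) U) :
    InitialDataSet.dataWeightedSobolevEDist s δ D₁ D₂ ≤
      InitialDataSet.dataWeightedSobolevEDist s' δ' D₁ D₂ := by
  unfold InitialDataSet.dataWeightedSobolevEDist
  exact add_le_add (weightedSobolevSeminorm_mono_exponents _ hs hδ _)
    (weightedSobolevSeminorm_mono_exponents _ (Nat.sub_le_sub_right hs 1) (by linarith) _)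

/-! ## §4 Glue, part 2 (PROVED): the capture body with a linear modulus; monotonicity of the
disprover's matrix `CaptureAt`; `C·dist ⇒ C·√dist` on balls of radius `≤ 1` -/

section Body

variable [Kerr.Facts] [Kerr.SliceFacts]

/-- The capture body with a LINEAR final-parameter modulus `L · dist` — verbatim
`Negative.CaptureAt` (far-complete `𝓘⁺`, `Cᵏ` convergence to a sub-extremal `g_{M',a'}`) with
`C·√dist` replaced by `L·dist`. What the Nash–Moser output bound delivers (card (i)); the card's
transfer statement `C⁺ = TwoCentreKerrCaptureLin` is `∀ χ₀ … CaptureLin …` locally in the centre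
(`captureLin_local`). -/
def CaptureLin (s : ℕ) (δ : ℝ) (k : ℕ) (M : ℝ) (hM : 0 ≤ M) (ε L a : ℝ) : Prop :=
  ∀ (D : InitialDataSet 𝓘(ℝ, E3) (Kerr.slice a M)) [D.metric.HasLeviCivita],
    D.IsVacuumConstraintSolution →
    InitialDataSet.dataWeightedSobolevEDist s δ D (Kerr.data M a M hM) < ENNReal.ofReal ε →
    ∀ 𝒟 : VacuumCauchyDevelopment D, 𝒟.IsMaximal →
      ∃ (M' a' : ℝ) (𝒟oc : Set 𝒟.carrier), Kerr.IsSubextremal M' a' ∧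
        𝒟.HasCompleteFutureNullInfinityFar ∧
        𝒟.toSpacetime.ConvergesToKerr 𝒟oc M' a' k ∧
        |M' - M| + |a' - a| ≤
          L * (InitialDataSet.dataWeightedSobolevEDist s δ D (Kerr.data M a M hM)).toReal

/-- The linear body is antitone in the basin radius. -/
theorem captureLin_anti_radius {s : ℕ} {δ : ℝ} {k : ℕ} {M : ℝ} {hM : 0 ≤ M} {ε ε' L a : ℝ}
    (hε : ε' ≤ ε) (h : CaptureLin s δ k M hM ε L a) : CaptureLin s δ k M hM ε' L a :=
  fun D _ hvac hdist 𝒟 hmax ↦ h D hvac (hdist.trans_le (ENNReal.ofReal_le_ofReal hε)) 𝒟 hmax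

/-- The disprover's matrix is antitone in the basin radius. -/
theorem captureAt_anti_radius {s : ℕ} {δ : ℝ} {k : ℕ} {M : ℝ} {hM : 0 ≤ M} {ε ε' C a : ℝ}
    (hε : ε' ≤ ε) (h : CaptureAt s δ k M hM ε C a) : CaptureAt s δ k M hM ε' C a :=
  fun D _ hvac hdist 𝒟 hmax ↦ h D hvac (hdist.trans_le (ENNReal.ofReal_le_ofReal hε)) 𝒟 hmax

/-- **Linear ⇒ square-root modulus on a ball of radius `ε ≤ 1`** (`d ≤ √d` on `[0, 1]`,
`L ≥ 0`): the Lipschitz body gives the crux's `C·√dist` body verbatim, with `C = L`. The slack is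
`3/2` in the exponent (card (ii): the truth is quadratic). -/
theorem captureAt_of_captureLin {s : ℕ} {δ : ℝ} {k : ℕ} {M : ℝ} {hM : 0 ≤ M} {ε L a : ℝ}
    (hε : ε ≤ 1) (hL : 0 ≤ L) (h : CaptureLin s δ k M hM ε L a) : CaptureAt s δ k M hM ε L a := by
  intro D _ hvac hdist 𝒟 hmax
  obtain ⟨M', a', 𝒟oc, hsub, hfar, hconv, hmod⟩ := h D hvac hdist 𝒟 hmax
  refine ⟨M', a', 𝒟oc, hsub, hfar, hconv, hmod.trans ?_⟩
  set d := InitialDataSet.dataWeightedSobolevEDist s δ D (Kerr.data M a M hM) with hd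
  have hd1 : d.toReal ≤ 1 := by
    have : d.toReal < ε := (ENNReal.lt_ofReal_iff_toReal_lt hdist.ne_top).1 hdist
    linarith
  have hd0 : 0 ≤ d.toReal := ENNReal.toReal_nonneg
  have hsq : d.toReal ≤ √d.toReal := by
    rcases hd0.eq_or_lt with h0 | hpos
    · simp [← h0]
    · calc d.toReal = √(d.toReal ^ 2) := (Real.sqrt_sq hd0).symm
        _ ≤ √d.toReal := Real.sqrt_le_sqrt (by nlinarith)
  exact mul_le_mul_of_nonneg_left hsq hL

/-- **Monotonicity of the capture matrix in its exponents and constant** (the ideator's stub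
`BodyMonoExponents`, now a theorem): larger `(s, δ)` shrink the data ball
(`dataWeightedSobolevEDist_mono_exponents`) and enlarge `√dist`, smaller `k` weakens the `Cᵏ`
convergence (`Spacetime.ConvergesTo.of_le`), larger `C ≥ 0` weakens the modulus. Needed because the
vendored exponents vary with the centre and the finite subcover takes `max s`, `max δ`, `min k`,
`max C`. -/
theorem captureAt_mono_exponents {s s' : ℕ} {δ δ' : ℝ} {k k' : ℕ} {M : ℝ} {hM : 0 ≤ M}
    {ε C C' a : ℝ} (hs : s ≤ s') (hδ : δ ≤ δ') (hk : k' ≤ k) (hC : 0 ≤ C) (hCC : C ≤ C')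
    (h : CaptureAt s δ k M hM ε C a) : CaptureAt s' δ' k' M hM ε C' a := by
  intro D _ hvac hdist 𝒟 hmax
  have hle : InitialDataSet.dataWeightedSobolevEDist s δ D (Kerr.data M a M hM) ≤
      InitialDataSet.dataWeightedSobolevEDist s' δ' D (Kerr.data M a M hM) :=
    dataWeightedSobolevEDist_mono_exponents hs hδ _ _
  obtain ⟨M', a', 𝒟oc, hsub, hfar, hconv, hmod⟩ := h D hvac (hle.trans_lt hdist) 𝒟 hmax
  refine ⟨M', a', 𝒟oc, hsub, hfar, Spacetime.ConvergesTo.of_le hconv hk, hmod.trans ?_⟩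
  have htoReal : (InitialDataSet.dataWeightedSobolevEDist s δ D (Kerr.data M a M hM)).toReal ≤
      (InitialDataSet.dataWeightedSobolevEDist s' δ' D (Kerr.data M a M hM)).toReal :=
    ENNReal.toReal_mono hdist.ne_top hle
  calc C * √(InitialDataSet.dataWeightedSobolevEDist s δ D (Kerr.data M a M hM)).toReal
      ≤ C * √(InitialDataSet.dataWeightedSobolevEDist s' δ' D (Kerr.data M a M hM)).toReal :=
        mul_le_mul_of_nonneg_left (Real.sqrt_le_sqrt htoReal) hC
    _ ≤ C' * √(InitialDataSet.dataWeightedSobolevEDist s' δ' D (Kerr.data M a M hM)).toReal :=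
        mul_le_mul_of_nonneg_right hCC (Real.sqrt_nonneg _)

end Body

/-! ## §5 Glue, part 3 (PROVED): fixing the orientation of the final spin -/

/-- For reals `a, a'` one of `a'`, `−a'` — call it `σ a'`, `σ = ±1` — satisfies
`|σ a' − a| = ||a'| − |a||` (same sign: `σ = 1`; opposite signs: `σ = −1`). Used to turn the
orientation-blind Lipschitz bound of S3 into the crux's `|a' − a|` after reflecting with S4. -/
theorem exists_sign_flip (a a' : ℝ) :
    ∃ σ : ℝ, (σ = 1 ∨ σ = -1) ∧ |σ * a' - a| = abs (|a'| - |a|) := by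
  rcases le_total 0 a with ha | ha <;> rcases le_total 0 a' with ha' | ha'
  · exact ⟨1, Or.inl rfl, by rw [one_mul, abs_of_nonneg ha, abs_of_nonneg ha']⟩
  · refine ⟨-1, Or.inr rfl, ?_⟩
    rw [neg_one_mul, abs_of_nonneg ha, abs_of_nonpos ha']
  · refine ⟨-1, Or.inr rfl, ?_⟩
    rw [neg_one_mul, abs_of_nonpos ha, abs_of_nonneg ha', show -a' - a = -(a' - -a) by ring,
      abs_neg]
  · refine ⟨1, Or.inl rfl, ?_⟩
    rw [one_mul, abs_of_nonpos ha, abs_of_nonpos ha', show -a' - -a = -(a' - a) by ring, abs_neg]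

/-! ## §5b Evidence for S4 (PROVED, not used by the composition): the Kerr–Schild form of the
tree is reflection-symmetric up to the sign of the spin

With `R = reflectY : (x⁰,x¹,x²,x³) ↦ (x⁰,x¹,−x²,x³)`: `Kerr.radius (−a) (R x) = Kerr.radius a x`,
`Kerr.rPlus M (−a) = Kerr.rPlus M a`, `Kerr.scalarH M (−a) (R x) = Kerr.scalarH M a x`,
`Kerr.nullCovector (−a) (R x) (R v) = Kerr.nullCovector a x v`, `η(R v, R w) = η(v, w)`, hence
`g_{M,−a}(R x)(R v, R w) = g_{M,a}(x)(v, w)` (`kerr_bilin_reflectY`) and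
`R x ∈ Kerr.exterior M (−a) ↔ x ∈ Kerr.exterior M a`. What remains for the S4 worker is transport
of `IsLateEmbedding` / `deviationCk` along the linear isometry `R` (manifold plumbing). -/

section Reflection

/-- The reflection `R(x⁰,x¹,x²,x³) = (x⁰,x¹,−x²,x³)` of `E4` (flips the orientation of the
rotation axis' complement; a linear isometry and an involution). -/
def reflectY (x : E4) : E4 := WithLp.toLp 2 fun μ ↦ if μ = 2 then -x μ else x μ

@[simp] theorem reflectY_apply_zero (x : E4) : reflectY x 0 = x 0 := by simp [reflectY]
@[simp] theorem reflectY_apply_one (x : E4) : reflectY x 1 = x 1 := by simp [reflectY]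
@[simp] theorem reflectY_apply_two (x : E4) : reflectY x 2 = -x 2 := by simp [reflectY]
@[simp] theorem reflectY_apply_three (x : E4) : reflectY x 3 = x 3 := by simp [reflectY]

/-- `R` is an involution. -/
theorem reflectY_reflectY (x : E4) : reflectY (reflectY x) = x := by
  ext μ
  fin_cases μ <;> simp [reflectY]

/-- `R` preserves the spatial radius `‖x⃗‖`. -/
theorem spatialNorm_reflectY (x : E4) : E4.spatialNorm (reflectY x) = E4.spatialNorm x := by
  have h1 := E4.spatialNorm_sq (reflectY x)
  have h2 := E4.spatialNorm_sq x
  rw [reflectY_apply_one, reflectY_apply_two, reflectY_apply_three, neg_sq] at h1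
  have h : E4.spatialNorm (reflectY x) ^ 2 = E4.spatialNorm x ^ 2 := by rw [h1, h2]
  exact (pow_left_inj₀ (E4.spatialNorm_nonneg _) (E4.spatialNorm_nonneg _) two_ne_zero).1 h

/-- `R` and `a ↦ −a` preserve the Kerr–Schild radius (it depends on `a²`, `‖x⃗‖`, `(x³)²`). -/
theorem radius_reflectY (a : ℝ) (x : E4) : Kerr.radius (-a) (reflectY x) = Kerr.radius a x := by
  simp only [Kerr.radius, spatialNorm_reflectY, neg_sq, reflectY_apply_three]

/-- `r₊(M, −a) = r₊(M, a)`. -/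
theorem rPlus_neg (M a : ℝ) : Kerr.rPlus M (-a) = Kerr.rPlus M a := by
  simp only [Kerr.rPlus, neg_sq]

/-- `R` and `a ↦ −a` preserve the Kerr–Schild scalar `H = M r³/(r⁴ + a² z²)`. -/
theorem scalarH_reflectY (M a : ℝ) (x : E4) :
    Kerr.scalarH M (-a) (reflectY x) = Kerr.scalarH M a x := by
  simp only [Kerr.scalarH, radius_reflectY, neg_sq, reflectY_apply_three]

/-- `ℓ_{−a}(R x)(R v) = ℓ_a(x)(v)` for the Kerr–Schild null covector
`ℓ = (1, (r x¹ + a x²)/(r² + a²), (r x² − a x¹)/(r² + a²), x³/r)` (Kerr 1963, eq. (5)). -/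
theorem nullCovector_reflectY (a : ℝ) (x v : E4) :
    Kerr.nullCovector (-a) (reflectY x) (reflectY v) = Kerr.nullCovector a x v := by
  simp only [Kerr.nullCovector, E4.covector_apply, Kerr.nullCovectorFun, Fin.sum_univ_four,
    Fin.isValue, Matrix.cons_val_zero, Matrix.cons_val_one, Matrix.cons_val, radius_reflectY,
    reflectY_apply_zero, reflectY_apply_one, reflectY_apply_two, reflectY_apply_three]
  ring

/-- `η(R v, R w) = η(v, w)`. -/
theorem minkowski_bilin_reflectY (v w : E4) :
    Minkowski.bilin (reflectY v) (reflectY w) = Minkowski.bilin v w := by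
  simp [Minkowski.bilin_apply, Fin.sum_univ_three]

/-- **The Kerr–Schild form is reflection-symmetric up to the sign of the spin**:
`g_{M,−a}(R x)(R v, R w) = g_{M,a}(x)(v, w)` — the pointwise identity behind `SpinReflection`. -/
theorem kerr_bilin_reflectY (M a : ℝ) (x v w : E4) :
    Kerr.bilin M (-a) (reflectY x) (reflectY v) (reflectY w) = Kerr.bilin M a x v w := by
  rw [Kerr.bilin_apply, Kerr.bilin_apply, scalarH_reflectY, nullCovector_reflectY,
    nullCovector_reflectY, minkowski_bilin_reflectY]

/-- `R` maps the Kerr exterior `{r > max r₊ 0}` of spin `a` onto that of spin `−a`. -/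
theorem reflectY_mem_exterior {M a : ℝ} {x : E4} :
    reflectY x ∈ Kerr.exterior M (-a) ↔ x ∈ Kerr.exterior M a := by
  rw [Kerr.mem_exterior, Kerr.mem_exterior, rPlus_neg, radius_reflectY]

end Reflection

/-! ## §6 Composition (PROVED): stubs ⇒ two-centre Lipschitz capture ⇒ `√` ⇒ compactness ⇒ crux -/

section Composition

variable [Kerr.Facts] [Kerr.SliceFacts]

/-- **Two-centre capture with LINEAR modulus from the four stubs** (the card's `C⁺ =
TwoCentreKerrCaptureLin`, here DERIVED): at a sub-extremal centre take `max` of the three exponent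
pairs, `min` of the three spin radii and basins, `k := k₀` of S3 fed into S1, `L⁺ := max L 0`;
S1 gives a sub-extremal `Cᵏ⁰`-limit `(M', a')`, S2 far-completeness, S3 the bound on
`|M' − M| + ||a'| − |a||` (the three balls are nested in the `max`-exponent ball by
`dataWeightedSobolevEDist_mono_exponents`), and `exists_sign_flip` + S4 replace `a'` by `−a'` when
the signs disagree. -/
theorem captureLin_local (h₁ : LocalKerrConvergence) (h₂ : FarCompleteNullInfinity)
    (h₃ : LipschitzFinalState) (h₄ : SpinReflection) {χ₀ : ℝ} (hχ₀ : |χ₀| < 1) :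
    ∃ (s : ℕ) (δ : ℝ) (k : ℕ), ∃ η > (0 : ℝ), ∀ (M : ℝ) (hM : 0 < M), ∃ ε > (0 : ℝ), ∃ L : ℝ,
      0 ≤ L ∧ ∀ a : ℝ, |a / M - χ₀| < η → |a| < M → CaptureLin s δ k M hM.le ε L a := by
  obtain ⟨s₃, δ₃, k₀, η₃, hη₃, H₃⟩ := h₃ χ₀ hχ₀
  obtain ⟨s₁, δ₁, η₁, hη₁, H₁⟩ := h₁ χ₀ hχ₀ k₀
  obtain ⟨s₂, δ₂, η₂, hη₂, H₂⟩ := h₂ χ₀ hχ₀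
  refine ⟨max s₁ (max s₂ s₃), max δ₁ (max δ₂ δ₃), k₀, min η₁ (min η₂ η₃),
    lt_min hη₁ (lt_min hη₂ hη₃), fun M hM ↦ ?_⟩
  obtain ⟨ε₁, hε₁, HH₁⟩ := H₁ M hM
  obtain ⟨ε₂, hε₂, HH₂⟩ := H₂ M hM
  obtain ⟨ε₃, hε₃, L, HH₃⟩ := H₃ M hM
  refine ⟨min ε₁ (min ε₂ ε₃), lt_min hε₁ (lt_min hε₂ hε₃), max L 0, le_max_right _ _,
    fun a ha haM ↦ ?_⟩
  have ha₁ : |a / M - χ₀| < η₁ := ha.trans_le (min_le_left _ _)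
  have ha₂ : |a / M - χ₀| < η₂ := ha.trans_le ((min_le_right _ _).trans (min_le_left _ _))
  have ha₃ : |a / M - χ₀| < η₃ := ha.trans_le ((min_le_right _ _).trans (min_le_right _ _))
  intro D _ hvac hdist 𝒟 hmax
  -- the three stub balls are contained in the `max`-exponent ball
  set d := InitialDataSet.dataWeightedSobolevEDist (max s₁ (max s₂ s₃)) (max δ₁ (max δ₂ δ₃)) D
    (Kerr.data M a M hM.le) with hd
  have hd₁ : InitialDataSet.dataWeightedSobolevEDist s₁ δ₁ D (Kerr.data M a M hM.le) ≤ d :=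
    dataWeightedSobolevEDist_mono_exponents (le_max_left _ _) (le_max_left _ _) _ _
  have hd₂ : InitialDataSet.dataWeightedSobolevEDist s₂ δ₂ D (Kerr.data M a M hM.le) ≤ d :=
    dataWeightedSobolevEDist_mono_exponents ((le_max_left _ _).trans (le_max_right _ _))
      ((le_max_left _ _).trans (le_max_right _ _)) _ _
  have hd₃ : InitialDataSet.dataWeightedSobolevEDist s₃ δ₃ D (Kerr.data M a M hM.le) ≤ d :=
    dataWeightedSobolevEDist_mono_exponents ((le_max_right _ _).trans (le_max_right _ _))
      ((le_max_right _ _).trans (le_max_right _ _)) _ _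
  have hlt₁ : InitialDataSet.dataWeightedSobolevEDist s₁ δ₁ D (Kerr.data M a M hM.le) <
      ENNReal.ofReal ε₁ :=
    hd₁.trans_lt (hdist.trans_le (ENNReal.ofReal_le_ofReal (min_le_left _ _)))
  have hlt₂ : InitialDataSet.dataWeightedSobolevEDist s₂ δ₂ D (Kerr.data M a M hM.le) <
      ENNReal.ofReal ε₂ :=
    hd₂.trans_lt (hdist.trans_le (ENNReal.ofReal_le_ofReal
      ((min_le_right _ _).trans (min_le_left _ _))))
  have hlt₃ : InitialDataSet.dataWeightedSobolevEDist s₃ δ₃ D (Kerr.data M a M hM.le) <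
      ENNReal.ofReal ε₃ :=
    hd₃.trans_lt (hdist.trans_le (ENNReal.ofReal_le_ofReal
      ((min_le_right _ _).trans (min_le_right _ _))))
  -- S1: a sub-extremal `Cᵏ⁰`-limit; S2: far-complete `𝓘⁺`; S3: the orientation-blind bound
  obtain ⟨M', a', 𝒟oc, hsub, hconv⟩ := HH₁ a ha₁ haM D hvac hlt₁ 𝒟 hmax
  have hfar : 𝒟.HasCompleteFutureNullInfinityFar := HH₂ a ha₂ haM D hvac hlt₂ 𝒟 hmax
  have hmod := HH₃ a ha₃ haM D hvac hlt₃ 𝒟 hmax M' a' 𝒟oc k₀ le_rfl hsub hconv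
  have hbound : |M' - M| + abs (|a'| - |a|) ≤ max L 0 * d.toReal :=
    calc |M' - M| + abs (|a'| - |a|)
        ≤ L * (InitialDataSet.dataWeightedSobolevEDist s₃ δ₃ D (Kerr.data M a M hM.le)).toReal :=
          hmod
      _ ≤ max L 0 *
            (InitialDataSet.dataWeightedSobolevEDist s₃ δ₃ D (Kerr.data M a M hM.le)).toReal :=
          mul_le_mul_of_nonneg_right (le_max_left _ _) ENNReal.toReal_nonneg
      _ ≤ max L 0 * d.toReal :=
          mul_le_mul_of_nonneg_left (ENNReal.toReal_mono hdist.ne_top hd₃) (le_max_right _ _)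
  -- S4: fix the orientation of the final spin
  obtain ⟨σ, hσ, hσeq⟩ := exists_sign_flip a a'
  rcases hσ with rfl | rfl
  · rw [one_mul] at hσeq
    refine ⟨M', a', 𝒟oc, hsub, hfar, hconv, ?_⟩
    rw [hσeq]
    exact hbound
  · rw [neg_one_mul] at hσeq
    refine ⟨M', -a', 𝒟oc, ?_, hfar, h₄ _ 𝒟oc M' a' k₀ hconv, ?_⟩
    · unfold Kerr.IsSubextremal at hsub ⊢
      rwa [abs_neg]
    · rw [hσeq]
      exact hbound

/-- **Two-centre capture in the crux's `√` form from the four stubs**: shrink the basin to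
`ε ≤ 1` (`captureLin_anti_radius`) and use `d ≤ √d` (`captureAt_of_captureLin`). This is the
ideator's `TwoCentreKerrCapture` / `firstLemmaC3_holds`, over `Negative.CaptureAt`. -/
theorem captureAt_local (h₁ : LocalKerrConvergence) (h₂ : FarCompleteNullInfinity)
    (h₃ : LipschitzFinalState) (h₄ : SpinReflection) {χ₀ : ℝ} (hχ₀ : |χ₀| < 1) :
    ∃ (s : ℕ) (δ : ℝ) (k : ℕ), ∃ η > (0 : ℝ), ∀ (M : ℝ) (hM : 0 < M), ∃ ε > (0 : ℝ), ∃ C : ℝ,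
      0 ≤ C ∧ ∀ a : ℝ, |a / M - χ₀| < η → |a| < M → CaptureAt s δ k M hM.le ε C a := by
  obtain ⟨s, δ, k, η, hη, H⟩ := captureLin_local h₁ h₂ h₃ h₄ hχ₀
  refine ⟨s, δ, k, η, hη, fun M hM ↦ ?_⟩
  obtain ⟨ε, hε, L, hL, HL⟩ := H M hM
  exact ⟨min ε 1, lt_min hε one_pos, L, hL, fun a ha haM ↦
    captureAt_of_captureLin (min_le_right _ _) hL
      (captureLin_anti_radius (min_le_left _ _) (HL a ha haM))⟩

/-- **Locally uniform ⇒ uniform on compact spin sets (the Lebesgue-number step)**: cover the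
compact segment of normalised spins `[−a₁, a₁] ⊂ (−1, 1)` by the spin balls of a local capture
statement, extract a finite subcover, take `max s`, `max δ`, `min k` over it (independent of `M`)
and, for each `M`, `min ε(M)`, `max C(M)`; `captureAt_mono_exponents` / `captureAt_anti_radius`
move each local body to the common parameters. The strict spin gap `a₁ < 1`
(`Negative.bulkCaptureFamily_false_without_spinGap`) is used exactly once — `[−a₁, a₁]` lies in
the open interval where centres exist — and `a₁ < 0` is the empty range
(`Negative.no_spin_of_neg`); `0 < M` (`_false_without_posMass`) is used to form `a/M`. Adapted from
the ideator's kernel-checked `firstLemmaC1_holds` (card `two-centre-lebesgue-cover`). -/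
theorem captureAt_uniform_of_local
    (hloc : ∀ χ₀ : ℝ, |χ₀| < 1 → ∃ (s : ℕ) (δ : ℝ) (k : ℕ), ∃ η > (0 : ℝ),
      ∀ (M : ℝ) (hM : 0 < M), ∃ ε > (0 : ℝ), ∃ C : ℝ, 0 ≤ C ∧
        ∀ a : ℝ, |a / M - χ₀| < η → |a| < M → CaptureAt s δ k M hM.le ε C a)
    {a₁ : ℝ} (ha₁ : a₁ < 1) :
    ∃ (s : ℕ) (δ : ℝ) (k : ℕ), ∀ (M : ℝ) (hM : 0 < M), ∃ ε > (0 : ℝ), ∃ C : ℝ,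
      ∀ a : ℝ, |a| ≤ a₁ * M → CaptureAt s δ k M hM.le ε C a := by
  classical
  -- vacuous case `a₁ < 0`
  rcases lt_or_ge a₁ 0 with hneg | hnn
  · exact ⟨0, 0, 0, fun M hM ↦ ⟨1, one_pos, 0, fun a ha ↦ (no_spin_of_neg hneg hM ha).elim⟩⟩
  -- the compact segment of normalised spins and the local data on it
  set K : Set ℝ := Icc (-a₁) a₁ with hK
  have hKc : IsCompact K := isCompact_Icc
  have hKsub : ∀ χ ∈ K, |χ| < 1 := fun χ hχ ↦ by
    rw [hK, mem_Icc] at hχ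
    exact abs_lt.2 ⟨by linarith [hχ.1], by linarith [hχ.2]⟩
  choose! s δ k η hη hcap using fun χ (hχ : χ ∈ K) ↦ hloc χ (hKsub χ hχ)
  have hcover : K ⊆ ⋃ χ ∈ K, Metric.ball χ (η χ) := fun χ hχ ↦
    mem_biUnion hχ (Metric.mem_ball_self (hη χ hχ))
  obtain ⟨t, htK, htfin, hsub⟩ :=
    hKc.elim_finite_subcover_image (fun χ _ ↦ Metric.isOpen_ball) hcover
  have hKne : K.Nonempty := ⟨0, by rw [hK, mem_Icc]; exact ⟨by linarith, hnn⟩⟩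
  have htne : t.Nonempty := by
    obtain ⟨x, hx⟩ := hKne
    have hx' := hsub hx
    simp only [mem_iUnion] at hx'
    obtain ⟨i, hi, -⟩ := hx'
    exact ⟨i, hi⟩
  -- exponents uniform over the finite subcover (independent of `M`)
  obtain ⟨is, -, hsmax⟩ := t.exists_max_image s htfin htne
  obtain ⟨id, -, hdmax⟩ := t.exists_max_image δ htfin htne
  obtain ⟨ik, -, hkmin⟩ := t.exists_min_image k htfin htne
  refine ⟨s is, δ id, k ik, fun M hM ↦ ?_⟩
  -- per-`M` basin and constant over the finite subcover
  choose! ε hε C hC0 hC using fun χ (hχ : χ ∈ t) ↦ hcap χ (htK hχ) M hM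
  obtain ⟨ie, hiet, hemin⟩ := t.exists_min_image ε htfin htne
  obtain ⟨ic, -, hcmax⟩ := t.exists_max_image C htfin htne
  refine ⟨ε ie, hε ie hiet, C ic, fun a ha ↦ ?_⟩
  -- locate the normalised spin `a/M` in the cover
  have hχK : a / M ∈ K := by
    rw [hK, mem_Icc, ← abs_le, abs_div, abs_of_pos hM, div_le_iff₀ hM]
    exact ha
  have ha' := hsub hχK
  simp only [mem_iUnion] at ha'
  obtain ⟨χ, hχt, hball⟩ := ha'
  have hdist : |a / M - χ| < η χ := by simpa [Metric.mem_ball, Real.dist_eq] using hball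
  have halt : |a| < M := by
    have : a₁ * M < 1 * M := mul_lt_mul_of_pos_right ha₁ hM
    linarith
  have hbody := hC χ hχt a hdist halt
  exact captureAt_anti_radius (hemin χ hχt)
    (captureAt_mono_exponents (hsmax χ hχt) (hdmax χ hχt) (hkmin χ hχt) (hC0 χ hχt)
      (hcmax χ hχt) hbody)

/-- The crux's matrix (`Negative.CaptureAt` under the crux's quantifier prefix) from the four
stubs. -/
theorem captureAt_uniform (h₁ : LocalKerrConvergence) (h₂ : FarCompleteNullInfinity)
    (h₃ : LipschitzFinalState) (h₄ : SpinReflection) {a₁ : ℝ} (ha₁ : a₁ < 1) :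
    ∃ (s : ℕ) (δ : ℝ) (k : ℕ), ∀ (M : ℝ) (hM : 0 < M), ∃ ε > (0 : ℝ), ∃ C : ℝ,
      ∀ a : ℝ, |a| ≤ a₁ * M → CaptureAt s δ k M hM.le ε C a :=
  captureAt_uniform_of_local (fun _ hχ₀ ↦ captureAt_local h₁ h₂ h₃ h₄ hχ₀) ha₁

end Composition

/-! ## §7 The skeleton theorem -/

/-- **Composition (the skeleton theorem).** The crux `BulkKerrCapture`, concluded BY NAME, as a
closed proof over the four registered stubs: `Negative.bulkKerrCapture_iff` (the route decl's
inlined sojourn clause is `HasCompleteFutureNullInfinityFar`) and `captureAt_uniform`. -/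
theorem BulkKerrCapture_of : BulkKerrCapture := by
  rw [bulkKerrCapture_iff]
  intro _ _ a₁ ha₁
  exact captureAt_uniform stub_localKerrConvergence stub_farCompleteNullInfinity
    stub_lipschitzFinalState stub_spinReflection ha₁

end Summit.FinalStateConjecture.FinalStateConjecture.Cruxes.BulkKerrCapture.FrozenChargeFlatModulus

end
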